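/-
Copyright (c) 2026. All rights reserved.
Released under Apache 2.0 license as described in the file LICENSE.
Authors: abc-iut cell, seat abc-iut-w6-d023 (gen 4; block C / W6, row «COR36-iii-TELE-MODEL»).
-/
import Literature.AnabelianGeometry.AbsoluteAnabelian.AbsTopIII.FrobeniusPictureMLFLogTeleFamilyGlue
import Literature.AnabelianGeometry.AbsoluteAnabelian.AbsTopIII.FrobeniusPictureMLFLogGlueCrossClosure
import Literature.AnabelianGeometry.AbsoluteAnabelian.AbsTopIII.MLFGaloisModelAffineWitnessSlimProofs
import HarnessLib

/-!
# [AbsTopIII] Cor. 3.6 (iii), second clause — the TELECORE half AT THE MLF MODEL `𝒳 = 𝒞^{MLF-sB}_{TF}`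

S. Mochizuki, *Topics in Absolute Anabelian Geometry III*, Cor. 3.6 (iii) p. 80 (`MochizukiAbsTopIII2015`,
kurims manuscript `paper:url-5493eb38cbb7`): "𝒟 admits a natural structure of observable 𝔖_log [...]; the family of
homotopies that constitutes 𝔖_log is compatible with the families of homotopies that constitute the core and telecore
structures of (i), (ii)".  The typed second clause splits into a CORES half (`LogObsCompatCoresStmt`) and a TELECORE half
(`LogObsCompatTelecoreStmt τ`, one family on the telecore diagram `𝒟_An` of a telecore `𝔗_An` of the printed shape `τ`
containing the telecore family `𝒥` and, along `𝒟_{≤3} ↪ 𝒟_An`, the `𝔖_log` family).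

State of the tree before this file.  Over ABSTRACT log-Frobenius data `Δ`: cores half from the named fact F-0360
`IotaOverGaloisStmt` (abc-iut-w5-d053, `logObsCompatCoresStmt_of_iotaOverGaloisStmt`); telecore half for every `(Δ, τ)`
with `id_⋎` fully faithful from the same named fact (abc-iut-w6-d025 / abc-iut-L4-t10,
`logObsCompatTelecoreStmt_of_iotaOverGaloisStmt`, p459273).  AT THE MLF MODEL of abc-iut-L4-t5's
`FrobeniusPictureMLFModel.lean` (every type `P` of MLF-Galois `TM`-pairs, every Cor-1.10 datum `I`): F-0360 is
DISCHARGED (`TFModel.iotaOverGaloisStmt_model`), whence the cores half `TFModel.logObsCompatCoresStmt_model (I)`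
(p437324) and its zero-binder instances at the non-vacuous sub-models `P₀` / `P₀^an`; the telecore half had been
instantiated only at the ARCHIMEDEAN models (`AbsTopIII.cor_4_5_iii_compatTelecore_arch`, p459467).

This PROOF-ONLY file (no `def`, nothing restated) closes the MLF-model column of the telecore half:

* `MonoAnabelianLogFrobeniusData.logObsCompatTelecoreStmt_of_iotaOverGaloisStmt` — at the printed Def-3.1 shape of
  the data (`id_⋎ = 𝟭`, so `hν` is free: `toNexusFullyFaithful`) the telecore half follows from F-0360 ALONE, for
  every telecore datum `τ`;
* `AbsTopIII.TFModel.logObsCompatTelecoreStmt_model (I) (τ)` — **UNCONDITIONAL at the MLF model**, every `P`, every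
  Cor-1.10 datum `I`, every telecore datum `τ` (binder `{I}` only, to form the data);
* `AbsTopIII.TFModel.cor_3_6_iii_compat_model (I)` — the WHOLE typed second clause of Cor. 3.6 (iii) at the model:
  cores half ∧ telecore half for every `τ`;
* zero-binder instances at the non-vacuous sub-models `𝒳_{P₀}` (`…_isAffineModel`) and `𝒳_{P₀^an}`
  (`…_isAffineModelAn`), at the printed first-row telecore datum `telecoreData = ⟨φ_An, 𝟙, η_An⟩` and for every `τ`.

HONEST SCOPE: model-level, not node-level; the witnesses of the cores half, of the telecore half and of Cor. 3.6 (ii)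
are a priori DIFFERENT families / telecores (abc-iut-L4-t10's joint-witness caveat F-L4t10g4-1; the joint form is
abc-iut-w6-d025's row «COR36-JOINT-TELE»).  Nothing here bears on [IUTchIII] Cor. 3.12; no side is taken on
inter-universal Teichmüller theory; typed ≠ endorsed.
-/

namespace Literature.AnabelianGeometry.AbsoluteAnabelian

open _root_.CategoryTheory _root_.Quiver

universe u

/-! ## At the printed Def-3.1 shape of the data: from F-0360 alone -/

namespace MonoAnabelianLogFrobeniusData

variable (𝔐 : MonoAnabelianLogFrobeniusData.{u})

/-- **[AbsTopIII] Cor. 3.6 (iii), second clause, TELECORE half, at the Def-3.1 shape of the data, from the named fact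
F-0360 `IotaOverGaloisStmt` alone**: for the `LogFrobeniusData` built from Def.-3.1-shaped inputs (`id_⋎ = 𝟭`, so the
fully-faithfulness hypothesis `hν` of `logObsCompatTelecoreStmt_of_iotaOverGaloisStmt` is discharged by
`toNexusFullyFaithful`) and EVERY telecore datum `τ`. [cite: MochizukiAbsTopIII2015, Corollary 3.6 (iii) p.80] -/
theorem logObsCompatTelecoreStmt_of_iotaOverGaloisStmt (τ : 𝔐.toLogFrobeniusData.TelecoreData)
    (hι : 𝔐.toLogFrobeniusData.IotaOverGaloisStmt) :
    𝔐.toLogFrobeniusData.LogObsCompatTelecoreStmt τ :=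
  𝔐.toLogFrobeniusData.logObsCompatTelecoreStmt_of_iotaOverGaloisStmt τ 𝔐.toNexusFullyFaithful hι

/-- **Both halves of the second clause of Cor. 3.6 (iii) at the Def-3.1 shape, from F-0360 alone** (cores half:
abc-iut-w5-d053's `logObsCompatCoresStmt_of_iotaOverGaloisStmt`). [cite: MochizukiAbsTopIII2015, Corollary 3.6 (iii) p.80] -/
theorem logObsCompat_of_iotaOverGaloisStmt (hι : 𝔐.toLogFrobeniusData.IotaOverGaloisStmt) :
    𝔐.toLogFrobeniusData.LogObsCompatCoresStmt ∧
      ∀ τ : 𝔐.toLogFrobeniusData.TelecoreData, 𝔐.toLogFrobeniusData.LogObsCompatTelecoreStmt τ :=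
  ⟨𝔐.toLogFrobeniusData.logObsCompatCoresStmt_of_iotaOverGaloisStmt hι,
    fun τ => 𝔐.logObsCompatTelecoreStmt_of_iotaOverGaloisStmt τ hι⟩

end MonoAnabelianLogFrobeniusData

/-! ## At the MLF model `𝒳 = 𝒞^{MLF-sB}_{TF}`: unconditional -/

namespace AbsTopIII

namespace TFModel

variable {p : ℕ} [Fact p.Prime] {P : ObjectProperty (TFModel p)} {D : Type 1} [Category.{1} D]

/-- **[AbsTopIII] Cor. 3.6 (iii), second clause, TELECORE half, AT THE MLF MODEL — UNCONDITIONAL**: for the model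
log-Frobenius data of abc-iut-L4-t5's `FrobeniusPictureMLFModel.lean` (every type `P`, every Cor-1.10 datum `I`) and
EVERY telecore datum `τ`, over a telecore `𝔗_An` of shape `τ` ONE family of homotopies on `𝒟_An` contains the telecore
family `𝒥` and the `𝔖_log` family — F-0360 holding at the model (`iotaOverGaloisStmt_model`).
[cite: MochizukiAbsTopIII2015, Corollary 3.6 (iii) p.80] -/
theorem logObsCompatTelecoreStmt_model (I : AnabelianInput p P D)
    (τ : (monoAnabelianData I).toLogFrobeniusData.TelecoreData) :
    (monoAnabelianData I).toLogFrobeniusData.LogObsCompatTelecoreStmt τ :=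
  (monoAnabelianData I).logObsCompatTelecoreStmt_of_iotaOverGaloisStmt τ (iotaOverGaloisStmt_model I)

/-- The telecore half at the model, at the PRINTED first-row telecore datum `⟨φ_An, 𝟙, η_An⟩` of Cor. 3.6 (ii)
(`telecoreData`, the datum of `telecoreStmt_model` / `shiftTelecoreCompatStmt_model`).
[cite: MochizukiAbsTopIII2015, Corollary 3.6 (iii) p.80] -/
theorem logObsCompatTelecoreStmt_model_telecoreData (I : AnabelianInput p P D) :
    (monoAnabelianData I).toLogFrobeniusData.LogObsCompatTelecoreStmt (monoAnabelianData I).telecoreData :=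
  logObsCompatTelecoreStmt_model I _

/-- **[AbsTopIII] Cor. 3.6 (iii), the WHOLE typed second clause AT THE MLF MODEL — UNCONDITIONAL**: cores half
(abc-iut-w5-d053's `logObsCompatCoresStmt_model`) ∧ telecore half for every telecore datum `τ`; binder `{I}` only.
(Separate witnesses; the joint form is row «COR36-JOINT-TELE».) [cite: MochizukiAbsTopIII2015, Corollary 3.6 (iii) p.80] -/
theorem cor_3_6_iii_compat_model (I : AnabelianInput p P D) :
    (monoAnabelianData I).toLogFrobeniusData.LogObsCompatCoresStmt ∧
      ∀ τ : (monoAnabelianData I).toLogFrobeniusData.TelecoreData,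
        (monoAnabelianData I).toLogFrobeniusData.LogObsCompatTelecoreStmt τ :=
  ⟨logObsCompatCoresStmt_model I, logObsCompatTelecoreStmt_model I⟩

/-- **All three typed compatibility clauses of Cor. 3.6 (iii)/(v) AT THE MLF MODEL, plus the telecore halves**:
(iii) cores ∧ (iii) telecore (∀ τ) ∧ (v) third sentence `ShiftCompatStmt` (abc-iut-w6-d023 gen 2) ∧ (v) fourth sentence
`ShiftTelecoreCompatStmt` at the printed telecore datum (abc-iut-w6-d025) — every `P`, every Cor-1.10 datum `I`, no
further binder. [cite: MochizukiAbsTopIII2015, Corollary 3.6 (iii),(v) p.80] -/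
theorem compat_all_model (I : AnabelianInput p P D) :
    (monoAnabelianData I).toLogFrobeniusData.LogObsCompatCoresStmt ∧
      (∀ τ : (monoAnabelianData I).toLogFrobeniusData.TelecoreData,
        (monoAnabelianData I).toLogFrobeniusData.LogObsCompatTelecoreStmt τ) ∧
      (monoAnabelianData I).toLogFrobeniusData.ShiftCompatStmt ∧
      (monoAnabelianData I).toLogFrobeniusData.ShiftTelecoreCompatStmt (monoAnabelianData I).telecoreData :=
  ⟨logObsCompatCoresStmt_model I, logObsCompatTelecoreStmt_model I, shiftCompatStmt_model I,
    shiftTelecoreCompatStmt_model I⟩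

/-! ## Zero-binder instances at the non-vacuous sub-models `𝒳_{P₀}` and `𝒳_{P₀^an}` -/

/-- **[AbsTopIII] Cor. 3.6 (iii), telecore half at `𝒳_{P₀}`** (the non-vacuous affine sub-model of
`MLFGaloisModelAffineWitnessFull.lean`, datum `AnabelianInput.ofFull`), at the printed telecore datum, ZERO binders.
[cite: MochizukiAbsTopIII2015, Corollary 3.6 (iii) p.80] -/
theorem logObsCompatTelecoreStmt_isAffineModel :
    (monoAnabelianData (AnabelianInput.ofFull p (IsAffineModel (p := p)) full_galP_isAffineModel)).toLogFrobeniusData.LogObsCompatTelecoreStmt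
      (monoAnabelianData (AnabelianInput.ofFull p (IsAffineModel (p := p)) full_galP_isAffineModel)).telecoreData :=
  logObsCompatTelecoreStmt_model _ _

/-- **[AbsTopIII] Cor. 3.6 (iii), the whole second clause at `𝒳_{P₀}`**, ZERO binders: cores half ∧ telecore half
for every telecore datum. [cite: MochizukiAbsTopIII2015, Corollary 3.6 (iii) p.80] -/
theorem cor_3_6_iii_compat_isAffineModel :
    (monoAnabelianData (AnabelianInput.ofFull p (IsAffineModel (p := p)) full_galP_isAffineModel)).toLogFrobeniusData.LogObsCompatCoresStmt ∧
      ∀ τ : (monoAnabelianData (AnabelianInput.ofFull p (IsAffineModel (p := p)) full_galP_isAffineModel)).toLogFrobeniusData.TelecoreData,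
        (monoAnabelianData (AnabelianInput.ofFull p (IsAffineModel (p := p)) full_galP_isAffineModel)).toLogFrobeniusData.LogObsCompatTelecoreStmt τ :=
  cor_3_6_iii_compat_model _

/-- **[AbsTopIII] Cor. 3.6 (iii), telecore half at the SLIM sub-model `𝒳_{P₀^an}`** (datum `AnabelianInput.ofFull` of
`MLFGaloisModelAffineWitnessSlimProofs.lean`), at the printed telecore datum, ZERO binders.
[cite: MochizukiAbsTopIII2015, Corollary 3.6 (iii) p.80] -/
theorem logObsCompatTelecoreStmt_isAffineModelAn :
    (monoAnabelianData (AnabelianInput.ofFull p (IsAffineModelAn (p := p)) full_galP_isAffineModelAn)).toLogFrobeniusData.LogObsCompatTelecoreStmt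
      (monoAnabelianData (AnabelianInput.ofFull p (IsAffineModelAn (p := p)) full_galP_isAffineModelAn)).telecoreData :=
  logObsCompatTelecoreStmt_model _ _

/-- **[AbsTopIII] Cor. 3.6 (iii), the whole second clause at `𝒳_{P₀^an}`**, ZERO binders.
[cite: MochizukiAbsTopIII2015, Corollary 3.6 (iii) p.80] -/
theorem cor_3_6_iii_compat_isAffineModelAn :
    (monoAnabelianData (AnabelianInput.ofFull p (IsAffineModelAn (p := p)) full_galP_isAffineModelAn)).toLogFrobeniusData.LogObsCompatCoresStmt ∧
      ∀ τ : (monoAnabelianData (AnabelianInput.ofFull p (IsAffineModelAn (p := p)) full_galP_isAffineModelAn)).toLogFrobeniusData.TelecoreData,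
        (monoAnabelianData (AnabelianInput.ofFull p (IsAffineModelAn (p := p)) full_galP_isAffineModelAn)).toLogFrobeniusData.LogObsCompatTelecoreStmt τ :=
  cor_3_6_iii_compat_model _

/-- **All four typed compatibility statements of Cor. 3.6 (iii)/(v) at `𝒳_{P₀^an}`**, ZERO binders (extends
`compat_isAffineModelAn` by the telecore half). [cite: MochizukiAbsTopIII2015, Corollary 3.6 (iii),(v) p.80] -/
theorem compat_all_isAffineModelAn :
    (monoAnabelianData (AnabelianInput.ofFull p (IsAffineModelAn (p := p)) full_galP_isAffineModelAn)).toLogFrobeniusData.LogObsCompatCoresStmt ∧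
      (∀ τ : (monoAnabelianData (AnabelianInput.ofFull p (IsAffineModelAn (p := p)) full_galP_isAffineModelAn)).toLogFrobeniusData.TelecoreData,
        (monoAnabelianData (AnabelianInput.ofFull p (IsAffineModelAn (p := p)) full_galP_isAffineModelAn)).toLogFrobeniusData.LogObsCompatTelecoreStmt τ) ∧
      (monoAnabelianData (AnabelianInput.ofFull p (IsAffineModelAn (p := p)) full_galP_isAffineModelAn)).toLogFrobeniusData.ShiftCompatStmt ∧
      (monoAnabelianData (AnabelianInput.ofFull p (IsAffineModelAn (p := p)) full_galP_isAffineModelAn)).toLogFrobeniusData.ShiftTelecoreCompatStmt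
        (monoAnabelianData (AnabelianInput.ofFull p (IsAffineModelAn (p := p)) full_galP_isAffineModelAn)).telecoreData :=
  compat_all_model _

end TFModel

end AbsTopIII

end Literature.AnabelianGeometry.AbsoluteAnabelian
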